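import Mathlib
import HarnessLib
import Summits.Ventures.LatticeQCDFlow.Exactness.CabibboMarinariKernel
import Summits.Ventures.LatticeQCDFlow.Exactness.CabibboMarinariQuat

/-!
# Haar measure on SU(2) is the law of a normalised Gaussian quaternion

HONEST FRAMING: exact (Metropolis-corrected) sampling algorithms for lattice gauge theory;
figures of merit are autocorrelation/cost numbers at stated couplings and volumes; no
continuum-physics claim.

Venture `LatticeQCDFlow` (cell pub-lqcd), topic `Exactness`, FANOUT row 9 (eng-latcore, the
engine `latflow.core`).  NEW WORK of the cell over Mathlib (the standard Gaussian `stdGaussian` of a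
finite-dimensional inner product space and its invariance under linear isometries,
`ProbabilityTheory.stdGaussian_map`; uniqueness of left-invariant measures,
`MeasureTheory.Measure.haarMeasure_unique`) and the tree's quaternion algebra
(`Exactness/SU2StapleSum.lean`, `CabibboMarinari.lean`, `CabibboMarinariQuat.lean`: `IsQuat`,
`quatOf`, the unit part `quatUnit` and its equivariance `quatUnit_quat_mul`) and Borel / compact /
second-countable structure of `SU(n)` (`Literature…GaugeGroups`, `CabibboMarinariKernel.lean`).
Nothing is cited as a fact.  Printed counterparts, NAMED ONLY: Muller 1959 (Commun. ACM 2: a point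
uniform on the sphere is a normalised Gaussian vector); Diaconis–Shahshahani 1987 §2 / Mezzadri 2007
(Notices AMS 54: Haar-random unitary matrices from Gaussians); the SU(2) ≅ S³ ⊂ ℍ folklore.

## What is proved (`R4 = EuclideanSpace ℝ (Fin 4)`, `SU(2) = Matrix.specialUnitaryGroup (Fin 2) ℂ`)

* `quatVec x = [[x₀ + i x₃, x₂ + i x₁], [−x₂ + i x₁, x₀ − i x₃]]` — the quaternion matrix with
  coordinates `x` (so that `a₀ = x₀` and `x_{Z_k} = x_k` in the generators of `SU2A0Stein.lean`);
  `vecQuat` its inverse on quaternions; `normSq_quatVec : |quatVec x|² = ‖x‖²`.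
* `lmulIso A : R4 ≃ₗᵢ[ℝ] R4` — LEFT MULTIPLICATION by `A ∈ SU(2)` read in these coordinates is a
  linear isometry (`quatVec_lmulIso : quatVec (lmulIso A x) = A * quatVec x`).
* `gaussUnit x ∈ SU(2)` — the unit part of `quatVec x` (`= quatVec (x/‖x‖)`, `1` at `x = 0`);
  measurable; **equivariant off the origin**: `gaussUnit (lmulIso A x) = A * gaussUnit x`
  (`gaussUnit_lmul`).
* `stdGaussian_singleton_zero` — the origin is Gaussian-null; hence the push-forward
  `(stdGaussian R4).map gaussUnit` is LEFT INVARIANT (`map_gaussUnit_mul_left`, via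
  `stdGaussian_map (lmulIso A)`), and by uniqueness of Haar measure
  **`map_gaussUnit_stdGaussian : (stdGaussian R4).map gaussUnit = haarProbability SU(2)`**:
  normalising four independent standard normals and reading them as a quaternion samples the Haar
  probability of SU(2) EXACTLY — the engine's Haar draw of an SU(2) element (hot starts; the Haar
  redraw of a zero-staple link), and the first half of the heat-bath direction law
  (`SU2HeatBathLaw.lean`: given `a₀`, the axis is uniform on `S²`).

NOT CLAIMED: anything about floating point or the pseudo-random generator; SU(N ≥ 3) Haar sampling
(Mezzadri's QR recipe) — not used by the engine's exactness battery.
-/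

namespace Summit.Ventures.LatticeQCDFlow.Exactness

open MeasureTheory ProbabilityTheory Matrix WithLp
open scoped ENNReal

/-- `ℝ⁴` with its Euclidean structure. -/
abbrev R4 := EuclideanSpace ℝ (Fin 4)

/-! ## §1 Quaternion coordinates -/

section Coordinates

/-- The quaternion matrix with real coordinates `x`: first row `(x₀ + i x₃, x₂ + i x₁)`. -/
noncomputable def quatVec (x : R4) : Matrix (Fin 2) (Fin 2) ℂ :=
  quatOf ((x 0 : ℂ) + (x 3 : ℂ) * Complex.I) ((x 2 : ℂ) + (x 1 : ℂ) * Complex.I)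

/-- `quatVec x` is a quaternion. -/
theorem isQuat_quatVec (x : R4) : IsQuat (quatVec x) := isQuat_quatOf _ _

/-- Entry `(0,0)`. -/
@[simp] theorem quatVec_apply_00 (x : R4) : quatVec x 0 0 = (x 0 : ℂ) + (x 3 : ℂ) * Complex.I := rfl

/-- Entry `(0,1)`. -/
@[simp] theorem quatVec_apply_01 (x : R4) : quatVec x 0 1 = (x 2 : ℂ) + (x 1 : ℂ) * Complex.I := rfl

/-- Entry `(1,0)`. -/
@[simp] theorem quatVec_apply_10 (x : R4) :
    quatVec x 1 0 = -(starRingEnd ℂ) ((x 2 : ℂ) + (x 1 : ℂ) * Complex.I) := rfl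

/-- Entry `(1,1)`. -/
@[simp] theorem quatVec_apply_11 (x : R4) :
    quatVec x 1 1 = (starRingEnd ℂ) ((x 0 : ℂ) + (x 3 : ℂ) * Complex.I) := rfl

/-- `|quatVec x|² = ‖x‖²`. -/
theorem normSq_quatVec (x : R4) : IsQuat.normSq (quatVec x) = ‖x‖ ^ 2 := by
  rw [EuclideanSpace.real_norm_sq_eq, Fin.sum_univ_four, IsQuat.normSq, quatVec_apply_00,
    quatVec_apply_01, Complex.normSq_add_mul_I, Complex.normSq_add_mul_I]
  ring

/-- `quatVec` is additive. -/
theorem quatVec_add (x y : R4) : quatVec (x + y) = quatVec x + quatVec y := by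
  ext i j
  fin_cases i <;> fin_cases j <;> (simp [quatVec, quatOf]; try ring)

/-- `quatVec` is real-homogeneous. -/
theorem quatVec_smul (c : ℝ) (x : R4) : quatVec (c • x) = (c : ℂ) • quatVec x := by
  ext i j
  fin_cases i <;> fin_cases j <;> (simp [quatVec, quatOf]; try ring)

/-- The real coordinates of (the first row of) a `2 × 2` complex matrix. -/
noncomputable def vecQuat (M : Matrix (Fin 2) (Fin 2) ℂ) : R4 :=
  toLp 2 ![(M 0 0).re, (M 0 1).im, (M 0 1).re, (M 0 0).im]

/-- Coordinate `0` of `vecQuat M` is `(M 0 0).re`. -/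
@[simp] theorem vecQuat_apply_0 (M : Matrix (Fin 2) (Fin 2) ℂ) : vecQuat M 0 = (M 0 0).re := rfl
/-- Coordinate `1` of `vecQuat M` is `(M 0 1).im`. -/
@[simp] theorem vecQuat_apply_1 (M : Matrix (Fin 2) (Fin 2) ℂ) : vecQuat M 1 = (M 0 1).im := rfl
/-- Coordinate `2` of `vecQuat M` is `(M 0 1).re`. -/
@[simp] theorem vecQuat_apply_2 (M : Matrix (Fin 2) (Fin 2) ℂ) : vecQuat M 2 = (M 0 1).re := rfl
/-- Coordinate `3` of `vecQuat M` is `(M 0 0).im`. -/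
@[simp] theorem vecQuat_apply_3 (M : Matrix (Fin 2) (Fin 2) ℂ) : vecQuat M 3 = (M 0 0).im := rfl

/-- `vecQuat` inverts `quatVec`. -/
theorem vecQuat_quatVec (x : R4) : vecQuat (quatVec x) = x := by
  ext i
  fin_cases i <;> simp

/-- `quatVec` inverts `vecQuat` on quaternions. -/
theorem quatVec_vecQuat {M : Matrix (Fin 2) (Fin 2) ℂ} (hM : IsQuat M) : quatVec (vecQuat M) = M := by
  ext i j
  fin_cases i <;> fin_cases j
  · simp
  · simp
  · simp [hM.offdiag]
  · simp [hM.diag]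

/-- `‖vecQuat M‖² = |M|²` (the quaternion squared norm of the first row). -/
theorem norm_vecQuat_sq (M : Matrix (Fin 2) (Fin 2) ℂ) : ‖vecQuat M‖ ^ 2 = IsQuat.normSq M := by
  rw [EuclideanSpace.real_norm_sq_eq, Fin.sum_univ_four, IsQuat.normSq, Complex.normSq_apply,
    Complex.normSq_apply]
  simp
  ring

/-- `vecQuat` is additive. -/
theorem vecQuat_add (M N : Matrix (Fin 2) (Fin 2) ℂ) : vecQuat (M + N) = vecQuat M + vecQuat N := by
  ext i
  fin_cases i <;> simp

/-- `vecQuat` is real-homogeneous. -/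
theorem vecQuat_smul (c : ℝ) (M : Matrix (Fin 2) (Fin 2) ℂ) : vecQuat ((c : ℂ) • M) = c • vecQuat M := by
  ext i
  fin_cases i <;> simp

end Coordinates

/-! ## §2 Left multiplication by `SU(2)` is a linear isometry of `ℝ⁴` -/

section LeftMul

/-- Left multiplication by a matrix, read in quaternion coordinates, as a real-linear map. -/
noncomputable def lmulLin (A : Matrix (Fin 2) (Fin 2) ℂ) : R4 →ₗ[ℝ] R4 where
  toFun x := vecQuat (A * quatVec x)
  map_add' x y := by rw [quatVec_add, Matrix.mul_add, vecQuat_add]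
  map_smul' c x := by rw [quatVec_smul, Matrix.mul_smul, vecQuat_smul, RingHom.id_apply]

/-- Pointwise formula. -/
theorem lmulLin_apply (A : Matrix (Fin 2) (Fin 2) ℂ) (x : R4) : lmulLin A x = vecQuat (A * quatVec x) := rfl

/-- For `A ∈ SU(2)`, left multiplication preserves the Euclidean norm (`|A Q|² = |Q|²`). -/
theorem norm_lmulLin (A : Matrix.specialUnitaryGroup (Fin 2) ℂ) (x : R4) :
    ‖lmulLin (A : Matrix (Fin 2) (Fin 2) ℂ) x‖ = ‖x‖ := by
  have h : ‖lmulLin (A : Matrix (Fin 2) (Fin 2) ℂ) x‖ ^ 2 = ‖x‖ ^ 2 := by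
    rw [lmulLin_apply, norm_vecQuat_sq, IsQuat.normSq_mul_of_mem A.2 (isQuat_quatVec x), normSq_quatVec]
  exact (pow_left_inj₀ (norm_nonneg _) (norm_nonneg _) two_ne_zero).1 h

/-- **Left multiplication by `A ∈ SU(2)` as a linear isometry of `ℝ⁴`.** -/
noncomputable def lmulIso (A : Matrix.specialUnitaryGroup (Fin 2) ℂ) : R4 ≃ₗᵢ[ℝ] R4 :=
  (LinearIsometry.mk (lmulLin (A : Matrix (Fin 2) (Fin 2) ℂ)) (norm_lmulLin A)).toLinearIsometryEquiv rfl

/-- Pointwise formula. -/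
theorem lmulIso_apply (A : Matrix.specialUnitaryGroup (Fin 2) ℂ) (x : R4) :
    lmulIso A x = vecQuat ((A : Matrix (Fin 2) (Fin 2) ℂ) * quatVec x) := by
  rw [lmulIso, LinearIsometry.coe_toLinearIsometryEquiv]
  rfl

/-- In quaternion form: `quatVec (lmulIso A x) = A * quatVec x`. -/
theorem quatVec_lmulIso (A : Matrix.specialUnitaryGroup (Fin 2) ℂ) (x : R4) :
    quatVec (lmulIso A x) = (A : Matrix (Fin 2) (Fin 2) ℂ) * quatVec x := by
  rw [lmulIso_apply]
  exact quatVec_vecQuat ((IsQuat.of_mem_specialUnitaryGroup A.2).mul (isQuat_quatVec x))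

/-- `lmulIso A` fixes the origin only: `lmulIso A x = 0 ↔ x = 0`. -/
theorem lmulIso_eq_zero_iff (A : Matrix.specialUnitaryGroup (Fin 2) ℂ) (x : R4) :
    lmulIso A x = 0 ↔ x = 0 := (lmulIso A).map_eq_zero_iff

end LeftMul

/-! ## §3 The normalised Gaussian quaternion -/

section GaussUnit

/-- **The unit part of the quaternion with coordinates `x`**, an element of `SU(2)` (`1` at `x = 0`). -/
noncomputable def gaussUnit (x : R4) : Matrix.specialUnitaryGroup (Fin 2) ℂ :=
  ⟨quatUnit (quatVec x), quatUnit_mem (isQuat_quatVec x)⟩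

/-- Underlying matrix. -/
@[simp] theorem coe_gaussUnit (x : R4) :
    (gaussUnit x : Matrix (Fin 2) (Fin 2) ℂ) = quatUnit (quatVec x) := rfl

/-- Off the origin, `gaussUnit x` is the quaternion of the normalised vector `x/‖x‖`. -/
theorem coe_gaussUnit_of_ne_zero {x : R4} (hx : x ≠ 0) :
    (gaussUnit x : Matrix (Fin 2) (Fin 2) ℂ) = quatVec (‖x‖⁻¹ • x) := by
  have hn : ‖x‖ ^ 2 ≠ 0 := pow_ne_zero 2 (norm_ne_zero_iff.2 hx)
  rw [coe_gaussUnit, quatUnit, normSq_quatVec, if_neg hn, quatVec_smul, Real.sqrt_sq (norm_nonneg x)]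

/-- At the origin, `gaussUnit 0 = 1`. -/
theorem gaussUnit_zero : gaussUnit 0 = 1 := by
  apply Subtype.ext
  rw [coe_gaussUnit, quatUnit, normSq_quatVec, if_pos (by simp)]
  rfl

/-- `quatVec` is continuous. -/
theorem continuous_quatVec : Continuous quatVec := by
  refine continuous_pi fun i => continuous_pi fun j => ?_
  have hc : ∀ k : Fin 4, Continuous fun x : R4 => ((x k : ℝ) : ℂ) := fun k =>
    Complex.continuous_ofReal.comp ((continuous_apply k).comp (PiLp.continuous_ofLp 2 _))
  fin_cases i <;> fin_cases j
  · exact (hc 0).add ((hc 3).mul continuous_const)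
  · exact (hc 2).add ((hc 1).mul continuous_const)
  · exact (Complex.continuous_conj.comp ((hc 2).add ((hc 1).mul continuous_const))).neg
  · exact Complex.continuous_conj.comp ((hc 0).add ((hc 3).mul continuous_const))

/-- `gaussUnit` is continuous off the origin. -/
theorem continuousOn_gaussUnit : ContinuousOn gaussUnit {(0 : R4)}ᶜ := by
  rw [Topology.IsInducing.subtypeVal.continuousOn_iff]
  have heq : Set.EqOn (fun x : R4 => quatVec (‖x‖⁻¹ • x))
      ((↑) ∘ gaussUnit : R4 → Matrix (Fin 2) (Fin 2) ℂ) {(0 : R4)}ᶜ := fun x hx => by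
    simp only [Function.comp_apply]
    rw [coe_gaussUnit_of_ne_zero hx]
  refine ContinuousOn.congr ?_ heq.symm
  exact continuous_quatVec.comp_continuousOn
    (((continuousOn_id.norm).inv₀ fun x hx => norm_ne_zero_iff.2 hx).smul continuousOn_id)

/-- `gaussUnit` is measurable (continuous off one point). -/
theorem measurable_gaussUnit : Measurable gaussUnit :=
  measurable_of_continuousOn_compl_singleton 0 continuousOn_gaussUnit

/-- **Equivariance off the origin**: `gaussUnit (A · x) = A * gaussUnit x` for `x ≠ 0`. -/
theorem gaussUnit_lmul (A : Matrix.specialUnitaryGroup (Fin 2) ℂ) {x : R4} (hx : x ≠ 0) :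
    gaussUnit (lmulIso A x) = A * gaussUnit x := by
  apply Subtype.ext
  change quatUnit (quatVec (lmulIso A x)) = (A : Matrix (Fin 2) (Fin 2) ℂ) * quatUnit (quatVec x)
  rw [quatVec_lmulIso]
  refine quatUnit_quat_mul A.2 (isQuat_quatVec x) ?_
  rw [normSq_quatVec]
  exact pow_ne_zero 2 (norm_ne_zero_iff.2 hx)

end GaussUnit

/-! ## §4 The law of the normalised Gaussian quaternion is Haar measure -/

section Haar

/-- The origin is null for the standard Gaussian on `ℝ⁴`. -/
theorem stdGaussian_singleton_zero : stdGaussian R4 {(0 : R4)} = 0 := by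
  haveI : NullSingletonClass (gaussianReal 0 1) := nullSingletonClass_gaussianReal one_ne_zero
  rw [← map_pi_eq_stdGaussian,
    Measure.map_apply (WithLp.measurable_toLp 2 _) (measurableSet_singleton _)]
  refine measure_mono_null (fun f hf => ?_) (Measure.pi_hyperplane (fun _ : Fin 4 => gaussianReal 0 1) 0 0)
  have h0 : toLp 2 f = (0 : R4) := hf
  have : f = 0 := by
    have := congrArg ofLp h0
    simpa using this
  simp [this]

/-- The push-forward of the standard Gaussian under `gaussUnit` is a probability measure on `SU(2)`. -/
instance isProbabilityMeasure_map_gaussUnit :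
    IsProbabilityMeasure ((stdGaussian R4).map gaussUnit) :=
  Measure.isProbabilityMeasure_map measurable_gaussUnit.aemeasurable

/-- **Left invariance**: for `A ∈ SU(2)`, `(A * ·)_* (gaussUnit_* N(0, I₄)) = gaussUnit_* N(0, I₄)` —
because `A` acts on `ℝ⁴` by a linear isometry, which preserves the standard Gaussian. -/
theorem map_gaussUnit_mul_left (A : Matrix.specialUnitaryGroup (Fin 2) ℂ) :
    ((stdGaussian R4).map gaussUnit).map (fun U => A * U) = (stdGaussian R4).map gaussUnit := by
  rw [Measure.map_map (measurable_const_mul A) measurable_gaussUnit]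
  have hae : (fun U => A * U) ∘ gaussUnit =ᵐ[stdGaussian R4] gaussUnit ∘ (lmulIso A) := by
    have hmem : {(0 : R4)}ᶜ ∈ ae (stdGaussian R4) := compl_mem_ae_iff.2 stdGaussian_singleton_zero
    filter_upwards [hmem] with x hx
    exact (gaussUnit_lmul A hx).symm
  rw [Measure.map_congr hae, ← Measure.map_map measurable_gaussUnit (lmulIso A).continuous.measurable,
    stdGaussian_map (lmulIso A)]

/-- The push-forward is a left-invariant measure on `SU(2)`. -/
instance isMulLeftInvariant_map_gaussUnit :
    ((stdGaussian R4).map gaussUnit).IsMulLeftInvariant :=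
  ⟨fun A => map_gaussUnit_mul_left A⟩

/-- **Haar measure on SU(2) is the law of a normalised Gaussian quaternion**: pushing the standard
Gaussian of `ℝ⁴` through `x ↦ quatVec (x/‖x‖)` gives exactly the Haar probability measure. -/
theorem map_gaussUnit_stdGaussian :
    (stdGaussian R4).map gaussUnit =
      Literature.MathematicalPhysics.QuantumFieldTheory.haarProbability
        (Matrix.specialUnitaryGroup (Fin 2) ℂ) := by
  have h := Measure.haarMeasure_unique ((stdGaussian R4).map gaussUnit) ⊤
  have h1 : ((stdGaussian R4).map gaussUnit) ((⊤ : TopologicalSpace.PositiveCompacts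
      (Matrix.specialUnitaryGroup (Fin 2) ℂ)) : Set (Matrix.specialUnitaryGroup (Fin 2) ℂ)) = 1 := by
    rw [TopologicalSpace.PositiveCompacts.coe_top]
    exact measure_univ
  rw [h, h1, one_smul]
  rfl

end Haar

end Summit.Ventures.LatticeQCDFlow.Exactness
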